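import Literature.NumberTheory.GaloisRepresentations.UnramifiedCompletion
import Literature.NumberTheory.GaloisRepresentations.LangTheorem
import Literature.NumberTheory.GaloisRepresentations.LocalFrobeniusDensity
import HarnessLib

/-!
# Lang's theorem over `𝒪̂_{F_nr}`: `X = G · σ₀(X)` is solvable in `GL_N(𝒪̂_{F_nr})`

Let `F` be a non-archimedean local field, `𝒪̂_{F_nr} = maxUnramifiedCompletion F` (complete
discrete valuation ring, uniformiser `ϖ_F`, residue field `k̄ = S ⧸ 𝔓` algebraically closed) with
its Galois action `galAut`, and `σ₀` an arithmetic Frobenius.  This file specialises the abstract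
Lang theorem of `LangTheorem.lean` (`FrobeniusSemilinear.exists_isUnit_eq_mul_map`) to this ring:

* `maxUnramifiedCompletion.residueMap F : 𝒪̂_{F_nr} →+* S ⧸ 𝔓` — the residue map (through
  Mathlib's `AdicCompletion.residueField_map_bijective` and `residueHom` of `MaxUnramifiedIntegers`),
  surjective with kernel `(ϖ_F)` (`residueMap_surjective`, `residueMap_eq_zero_iff`), compatible
  with `𝒪_{F_nr} → S ⧸ 𝔓` (`residueMap_algebraMap`) and with Frobenius
  (`IsAbsArithFrob.residueMap_galAut : res (σ₀ x) = (res x) ^ q`);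
* `maxUnramifiedCompletion.exists_sub_algebraMap_mem_pow` — density of `𝒪_{F_nr}` modulo `𝔪̂ⁿ`;
* `IsAbsArithFrob.exists_isUnit_eq_mul_galAut` — **Lang's theorem / Hilbert 90 over `F̂_nr`**:
  for every invertible `G ∈ M_N(𝒪̂_{F_nr})` there is an invertible `X` with `X = G · σ₀(X)`
  (Fontaine 1990, A1.2.6; Serre, *Local Fields*, Ch. XIII §5).

Definitions: `maxUnramifiedCompletion.residueMap`. No named facts.

## References

* [SerreLocalFields1979] J.-P. Serre, *Local Fields*, GTM 67, Ch. XIII §5.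
* J.-M. Fontaine, *Représentations p-adiques des corps locaux I* (1990), A1.2.6.
-/

noncomputable section

open ValuativeRel Field IsLocalRing
open scoped Pointwise

namespace Literature.NumberTheory.GaloisRepresentations
namespace IsNonarchimedeanLocalField

universe u

variable (F : Type u) [Field F] [ValuativeRel F] [TopologicalSpace F] [IsNonarchimedeanLocalField F]

attribute [local instance] Ideal.Quotient.field

/-! ### The residue map `𝒪̂_{F_nr} → S ⧸ 𝔓` -/

/-- `𝒪_{F_nr} ⧸ 𝔪 ≃ S ⧸ 𝔓`, induced by the surjective reduction `residueHom` whose kernel is `𝔪`.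
[cite: SerreLocalFields1979, Ch. IV §4 Cor. 2 to Prop. 16] -/
def maxUnramifiedIntegers.residueFieldEquiv :
    ResidueField (maxUnramifiedIntegers F) ≃+* absIntegers 𝒪[F] F ⧸ absMaximalIdeal F :=
  (Ideal.quotEquivOfEq (maxUnramifiedIntegers.ker_residueHom (F := F)).symm).trans
    (RingHom.quotientKerEquivOfSurjective maxUnramifiedIntegers.residueHom_surjective)

/-- `residueFieldEquiv (residue b) = residueHom b`. [folklore] -/
@[simp] theorem maxUnramifiedIntegers.residueFieldEquiv_residue (b : maxUnramifiedIntegers F) :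
    maxUnramifiedIntegers.residueFieldEquiv F (IsLocalRing.residue _ b) = maxUnramifiedIntegers.residueHom F b := rfl

/-- `𝒪_{F_nr} ⧸ 𝔪 ≃ 𝒪̂_{F_nr} ⧸ 𝔪̂` (Mathlib `AdicCompletion.residueField_map_bijective`). [folklore] -/
def maxUnramifiedCompletion.residueFieldEquiv :
    ResidueField (maxUnramifiedIntegers F) ≃+* ResidueField (maxUnramifiedCompletion F) :=
  RingEquiv.ofBijective (IsLocalRing.ResidueField.map (algebraMap (maxUnramifiedIntegers F) (maxUnramifiedCompletion F)))
    (AdicCompletion.residueField_map_bijective (maxUnramifiedIntegers F))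

/-- `residueFieldEquiv (residue b) = residue (ι b)`. [folklore] -/
theorem maxUnramifiedCompletion.residueFieldEquiv_residue (b : maxUnramifiedIntegers F) :
    maxUnramifiedCompletion.residueFieldEquiv F (IsLocalRing.residue _ b) =
      IsLocalRing.residue _ (algebraMap (maxUnramifiedIntegers F) (maxUnramifiedCompletion F) b) := by
  change IsLocalRing.ResidueField.map _ (IsLocalRing.residue _ b) = _
  rw [IsLocalRing.ResidueField.map_residue]

/-- **The residue map `𝒪̂_{F_nr} → k̄ = S ⧸ 𝔓`.** [cite: SerreLocalFields1979, Ch. IV §4 Cor. 2 to Prop. 16] -/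
def maxUnramifiedCompletion.residueMap : maxUnramifiedCompletion F →+* absIntegers 𝒪[F] F ⧸ absMaximalIdeal F :=
  (maxUnramifiedIntegers.residueFieldEquiv F).toRingHom.comp
    ((maxUnramifiedCompletion.residueFieldEquiv F).symm.toRingHom.comp (IsLocalRing.residue (maxUnramifiedCompletion F)))

variable {F}

/-- The residue map extends `residueHom : 𝒪_{F_nr} → S ⧸ 𝔓`. [folklore] -/
@[simp] theorem maxUnramifiedCompletion.residueMap_algebraMap (b : maxUnramifiedIntegers F) :
    maxUnramifiedCompletion.residueMap F (algebraMap (maxUnramifiedIntegers F) (maxUnramifiedCompletion F) b) =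
      maxUnramifiedIntegers.residueHom F b := by
  change maxUnramifiedIntegers.residueFieldEquiv F ((maxUnramifiedCompletion.residueFieldEquiv F).symm
    (IsLocalRing.residue _ (algebraMap (maxUnramifiedIntegers F) (maxUnramifiedCompletion F) b))) = _
  rw [← maxUnramifiedCompletion.residueFieldEquiv_residue, RingEquiv.symm_apply_apply,
    maxUnramifiedIntegers.residueFieldEquiv_residue]

/-- `res x = 0 ↔ x ∈ 𝔪̂`. [folklore] -/
theorem maxUnramifiedCompletion.residueMap_eq_zero_iff_mem (x : maxUnramifiedCompletion F) :
    maxUnramifiedCompletion.residueMap F x = 0 ↔ x ∈ maximalIdeal (maxUnramifiedCompletion F) := by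
  change maxUnramifiedIntegers.residueFieldEquiv F ((maxUnramifiedCompletion.residueFieldEquiv F).symm
    (IsLocalRing.residue _ x)) = 0 ↔ _
  rw [map_eq_zero_iff _ (maxUnramifiedIntegers.residueFieldEquiv F).injective,
    map_eq_zero_iff _ (maxUnramifiedCompletion.residueFieldEquiv F).symm.injective, IsLocalRing.residue_eq_zero_iff]

/-- `res x = 0 ↔ x ∈ (ϖ_F)`. [folklore] -/
theorem maxUnramifiedCompletion.residueMap_eq_zero_iff {ϖ : 𝒪[F]} (hϖ : Irreducible ϖ) (x : maxUnramifiedCompletion F) :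
    maxUnramifiedCompletion.residueMap F x = 0 ↔
      x ∈ Ideal.span {algebraMap 𝒪[F] (maxUnramifiedCompletion F) ϖ} := by
  rw [maxUnramifiedCompletion.residueMap_eq_zero_iff_mem, maxUnramifiedCompletion.maximalIdeal_eq_span_uniformizer hϖ]

/-- The residue map is surjective. [folklore] -/
theorem maxUnramifiedCompletion.residueMap_surjective : Function.Surjective (maxUnramifiedCompletion.residueMap F) :=
  (maxUnramifiedIntegers.residueFieldEquiv F).surjective.comp
    ((maxUnramifiedCompletion.residueFieldEquiv F).symm.surjective.comp IsLocalRing.residue_surjective)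

/-- **Frobenius compatibility**: `res (σ₀ x) = (res x) ^ q` for an arithmetic Frobenius `σ₀`.
[cite: TateCorvallis1979, §1.4 (1.4.1)] -/
theorem IsAbsArithFrob.residueMap_galAut {σ₀ : absoluteGaloisGroup F} (hσ₀ : IsAbsArithFrob σ₀)
    (x : maxUnramifiedCompletion F) :
    maxUnramifiedCompletion.residueMap F (maxUnramifiedCompletion.galAut F σ₀ x) =
      maxUnramifiedCompletion.residueMap F x ^ residueFieldCard F := by
  obtain ⟨b, hb⟩ := maxUnramifiedCompletion.exists_sub_of_mem_maximalIdeal x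
  set m := x - algebraMap (maxUnramifiedIntegers F) (maxUnramifiedCompletion F) b with hm
  have hx : x = algebraMap (maxUnramifiedIntegers F) (maxUnramifiedCompletion F) b + m := by rw [hm]; abel
  have hm0 : maxUnramifiedCompletion.residueMap F m = 0 :=
    (maxUnramifiedCompletion.residueMap_eq_zero_iff_mem m).2 hb
  have hσm0 : maxUnramifiedCompletion.residueMap F (maxUnramifiedCompletion.galAut F σ₀ m) = 0 :=
    (maxUnramifiedCompletion.residueMap_eq_zero_iff_mem _).2 (maxUnramifiedCompletion.galAut_mem_maximalIdeal σ₀ hb)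
  rw [hx, map_add, map_add, maxUnramifiedCompletion.galAut_algebraMap', map_add, hσm0, hm0, add_zero, add_zero,
    maxUnramifiedCompletion.residueMap_algebraMap, maxUnramifiedCompletion.residueMap_algebraMap,
    IsAbsArithFrob.residueHom_smul hσ₀]

/-! ### Density of `𝒪_{F_nr}` modulo `𝔪̂ⁿ` -/

/-- **`𝒪_{F_nr}` is dense in `𝒪̂_{F_nr}`**: every element is congruent to the image of an element of
`𝒪_{F_nr}` modulo `𝔪̂ ^ n` (induction on `n` from the case `n = 1`, using `𝔪̂ = ϖ 𝒪̂_{F_nr}`).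
[cite: Matsumura1987, Thm. 8.11] -/
theorem maxUnramifiedCompletion.exists_sub_algebraMap_mem_pow (x : maxUnramifiedCompletion F) (n : ℕ) :
    ∃ b : maxUnramifiedIntegers F,
      x - algebraMap (maxUnramifiedIntegers F) (maxUnramifiedCompletion F) b ∈
        maximalIdeal (maxUnramifiedCompletion F) ^ n := by
  obtain ⟨ϖ, hϖ⟩ := IsDiscreteValuationRing.exists_irreducible 𝒪[F]
  have hspan := maxUnramifiedCompletion.maximalIdeal_eq_span_uniformizer (F := F) hϖ
  induction n generalizing x with
  | zero => exact ⟨0, by rw [pow_zero, Ideal.one_eq_top]; exact Submodule.mem_top⟩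
  | succ n ih =>
    obtain ⟨b₁, hb₁⟩ := maxUnramifiedCompletion.exists_sub_of_mem_maximalIdeal x
    rw [hspan, Ideal.mem_span_singleton] at hb₁
    obtain ⟨x₁, hx₁⟩ := hb₁
    obtain ⟨b', hb'⟩ := ih x₁
    refine ⟨b₁ + algebraMap 𝒪[F] (maxUnramifiedIntegers F) ϖ * b', ?_⟩
    rw [hspan, Ideal.span_singleton_pow, Ideal.mem_span_singleton] at hb' ⊢
    obtain ⟨c, hc⟩ := hb'
    refine ⟨c, ?_⟩
    rw [map_add, map_mul, ← maxUnramifiedCompletion.algebraMap_eq, ← sub_sub, hx₁, ← mul_sub, hc, pow_succ]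
    ring

/-! ### Lang's theorem over `𝒪̂_{F_nr}` -/

/-- **Lang's theorem / Hilbert 90 over `F̂_nr`**: for an arithmetic Frobenius `σ₀` and every invertible
`G ∈ M_N(𝒪̂_{F_nr})` there is an invertible `X ∈ M_N(𝒪̂_{F_nr})` with `X = G · σ₀(X)` — the
specialisation of `FrobeniusSemilinear.exists_isUnit_eq_mul_map` (`R = 𝒪̂_{F_nr}`, `π = ϖ_F`,
`res : 𝒪̂_{F_nr} → k̄` algebraically closed, `φ = σ₀` lifting `x ↦ x ^ q`).  Fontaine 1990, A1.2.6
(`H¹(G_K, GL_n(K̂^nr))` and unramified representations); Serre, *Local Fields*, Ch. XIII §5.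
[cite: SerreLocalFields1979, Ch. XIII §5] -/
theorem IsAbsArithFrob.exists_isUnit_eq_mul_galAut {σ₀ : absoluteGaloisGroup F} (hσ₀ : IsAbsArithFrob σ₀) {N : ℕ}
    {G : Matrix (Fin N) (Fin N) (maxUnramifiedCompletion F)} (hG : IsUnit G) :
    ∃ X : Matrix (Fin N) (Fin N) (maxUnramifiedCompletion F),
      IsUnit X ∧ X = G * (maxUnramifiedCompletion.galAut F σ₀).toRingHom.mapMatrix X := by
  obtain ⟨ϖ, hϖ⟩ := IsDiscreteValuationRing.exists_irreducible 𝒪[F]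
  set π : maxUnramifiedCompletion F := algebraMap 𝒪[F] (maxUnramifiedCompletion F) ϖ with hπ
  have hspan := maxUnramifiedCompletion.maximalIdeal_eq_span_uniformizer (F := F) hϖ
  haveI : IsAdicComplete (Ideal.span {π}) (maxUnramifiedCompletion F) := by
    rw [← hspan]; infer_instance
  haveI : IsAlgClosed (absIntegers 𝒪[F] F ⧸ absMaximalIdeal F) := isAlgClosed_quotient_absMaximalIdeal F
  obtain ⟨τ, hτ⟩ := exists_ringHom_apply_eq_pow_residueFieldCard F
  refine FrobeniusSemilinear.exists_isUnit_eq_mul_map π (maxUnramifiedCompletion.galAut F σ₀).toRingHom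
    (maxUnramifiedCompletion.residueMap F) τ maxUnramifiedCompletion.residueMap_surjective
    (fun x => maxUnramifiedCompletion.residueMap_eq_zero_iff hϖ x) hτ (one_lt_residueFieldCard F) ?_ ?_ hG
  · exact maxUnramifiedCompletion.galAut_algebraMap σ₀ ϖ
  · intro x
    rw [hτ]
    exact IsAbsArithFrob.residueMap_galAut hσ₀ x

end IsNonarchimedeanLocalField
end Literature.NumberTheory.GaloisRepresentations

end
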